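import Mathlib
import Summits.CriticalPhenomena.PercolationContinuityZ3.Theorems.PercNearOneGluingNoHeavyLowerTailOrientedAntipodalHallTwoSidedCertificate

/-!
# Co-intersecting antipodal Hall on three petals: every type set except the full one

Helper file for crux `stmt-CriticalPhenomena-4575` (`NoHeavyLowerTail`, route `PercNearOneGluingNoHeavy`), hull-port seat
`prim-hp-7` (generation 54); `--supports stmt-CriticalPhenomena-4575`.  Everything here is PROVED (no `sorry`, no new
definitions); vocabulary of `…AntipodalStrongHarris` / `…OrientedAntipodalHall` (prim-ineq-gen-1/3): a monotone labelling
`f : Finset α → Lab k` (`B < C_p < A`, petals incomparable), a ground set `S`, antipodal bads `X ⊆ S` of type `(i X, j X)`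
(`f X = C_{i X}`, `f (S \ X) = C_{j X}`), goods `U ⊆ S` (`f U = A`, `f (S \ U) = B`).

**The IC/CoI-Kleitman programme on three petals (memo `prim-hp-7/FROM-prim-hp-7-g54-THREE-PETALS.md`).**  Up to renaming
the petals and reversing all types there are 12 nonempty type sets on three petals `a, b, c`; the Hall count
`#D ≤ #{goods above D}` was known for 8 of them (separated / bipartite / acyclic type sets, and the cyclic triangle of
prim-ineq-gen-3), and the four open ones were `T4' = {ab, ac, ba, bc}`, `T4 = {ab, ac, ba, cb}`, `T5 = {ab, ac, ba, bc, ca}`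
and the full set `T6`.  Since `T4, T4' ⊆ T5` up to symmetry, the theorem below settles every type set on three petals
except `T6`, for CO-INTERSECTING families (`X ∪ Y ≠ S`; co-intersection only restricts the two opposite pairs
`{ab, ba}`, `{ac, ca}` and is necessary there).

**Theorem (`card_le_card_goods_above_of_coint_fiveTypes`).**  Let `D` be a co-intersecting family of antipodal bads whose
types lie in `T5 = {(a,b), (a,c), (b,a), (b,c), (c,a)}` (`a, b, c` distinct petals).  Then at least `#D` good sets lie
above members of `D`; equivalently (`exists_injective_good_above_of_coint_fiveTypes`) the bads have distinct good
representatives above them.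

**Proof** = one explicit certificate fed to prim-ineq-gen-3's socket `card_le_card_goods_above_of_orderedTwoSided`
(ordered Marica–Schönheim with pseudo-sets), combining hp-7's TWO-BLOCK filing (gen 52, 'Conjecture TF') with ONE whole
pseudo-class: members are the bads of tail `a` THEMSELVES (plain; last block) and the COMPLEMENTS `S \ X` of the bads of
types `(b,a), (b,c), (c,a)`; pseudo-sets are all `E ⊆ S` with `f E = C_c`, `f (S \ E) = A` that are disjoint from a
bad; ranks: block 0 = complements of the `(b,c)`-bads and the pseudo-sets, block 1 = complements of the `(b,a)`- and
`(c,a)`-bads, block 2 = the plain members, each block by non-increasing size.  Label bookkeeping: every element of the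
family is a subset of `S` with set-label `C_a` or `C_c` and complement-label `C_b`, `C_c` or `A`; the only label
coincidences along the ranks produce differences with set-label `≤ C_c` and complement-label `A`, i.e. certified
co-goods or pseudo-sets; non-containment along the ranks is by size inside a block, by labels across blocks, and by
co-intersection for a complement `S \ X` (`X` of type `(b,a)`) against a plain `(a,b)`-bad.  Exhaustively machine-checked
beforehand on 4.7·10⁶ random families (`|S| ≤ 7`), 0 failures.  (prim-hp-7 gen 54, 2026-08-22.)
-/

namespace Summit.CriticalPhenomena.PercolationContinuityZ3.Theorems

namespace OrientedAntipodalHall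

open Finset AntipodalStrongHarris AntipodalStrongHarris.Lab OrderedDifferences
open scoped FinsetFamily

variable {α : Type*} [DecidableEq α] {k : ℕ}

omit [DecidableEq α] in
/-- A label below a petal `C_c` that lies on a subset is `B` or `C_c` (restated for subsets: if `Z ⊆ U` and
`f U = C_c` then `f Z = B ∨ f Z = C_c`). -/
theorem label_sub_of_petal {f : Finset α → Lab k} (hf : ∀ ⦃X Y : Finset α⦄, X ⊆ Y → f X ≤ f Y)
    {Z U : Finset α} {c : Fin k} (hZU : Z ⊆ U) (hU : f U = petal c) : f Z = bot ∨ f Z = petal c :=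
  eq_bot_or_eq_of_le_petal (hU ▸ hf hZU)

omit [DecidableEq α] in
/-- If `U ⊆ W` and `f U = A` then `f W = A`. -/
theorem label_top_of_subset {f : Finset α → Lab k} (hf : ∀ ⦃X Y : Finset α⦄, X ⊆ Y → f X ≤ f Y)
    {U W : Finset α} (hUW : U ⊆ W) (hU : f U = top) : f W = top :=
  eq_top_of_top_le (hU ▸ hf hUW)

/-- **Co-intersecting antipodal Hall count for the five-type class `T5 = {ab, ac, ba, bc, ca}` on three petals**
(hence for `T4 = {ab, ac, ba, cb}` and `T4' = {ab, ac, ba, bc}` and all their sub-type-sets).  `f` monotone, `D` a family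
of antipodal bads of `S` whose types `(i X, j X)` all lie in `{(a,b), (a,c), (b,a), (b,c), (c,a)}` for three distinct
petals `a, b, c`, pairwise co-intersecting (`X ∪ Y ≠ S`).  Then at least `#D` good sets (`f U = A`, `f (S \ U) = B`,
`U ⊆ S`) contain a member of `D`. [this work] -/
theorem card_le_card_goods_above_of_coint_fiveTypes (S : Finset α) {f : Finset α → Lab k}
    (hf : ∀ ⦃X Y : Finset α⦄, X ⊆ Y → f X ≤ f Y) (D : Finset (Finset α)) (i j : Finset α → Fin k)
    (hDS : ∀ X ∈ D, X ⊆ S) (hDi : ∀ X ∈ D, f X = petal (i X)) (hDj : ∀ X ∈ D, f (S \ X) = petal (j X))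
    {a b c : Fin k} (hab : a ≠ b) (hac : a ≠ c) (hbc : b ≠ c)
    (hT : ∀ X ∈ D, (i X = a ∧ (j X = b ∨ j X = c)) ∨ (i X = b ∧ (j X = a ∨ j X = c)) ∨ (i X = c ∧ j X = a))
    (hco : ∀ X ∈ D, ∀ Y ∈ D, X ∪ Y ≠ S) :
    #D ≤ #{U ∈ S.powerset | f U = top ∧ f (S \ U) = bot ∧ ∃ X ∈ D, X ⊆ U} := by
  classical
  have hij : ∀ X ∈ D, i X ≠ j X := by
    intro X hX h
    rcases hT X hX with ⟨h1, h2 | h2⟩ | ⟨h1, h2 | h2⟩ | ⟨h1, h2⟩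
    · exact hab (h1 ▸ h2 ▸ h)
    · exact hac (h1 ▸ h2 ▸ h)
    · exact hab (h2 ▸ h1 ▸ h.symm)
    · exact hbc (h1 ▸ h2 ▸ h)
    · exact hac (h2 ▸ h1 ▸ h.symm)
  -- members: plain for tail `a`, complemented otherwise
  let M : Finset α → Finset α := fun X => if i X = a then X else S \ X
  have hMpl : ∀ X, i X = a → M X = X := fun X h => by simp only [M, h, if_true]
  have hMco : ∀ X, i X ≠ a → M X = S \ X := fun X h => by simp only [M, h, if_false]
  have hMS : ∀ X ∈ D, M X ⊆ S := by
    intro X hX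
    by_cases h : i X = a
    · rw [hMpl X h]; exact hDS X hX
    · rw [hMco X h]; exact sdiff_subset
  -- set-label of a member: `C_a` (plain, or complement of a `(b,a)`/`(c,a)`-bad) or `C_c` (complement of a `(b,c)`-bad)
  -- complement-label of a member: `C_b` or `C_c`, and `C_c` only for a plain `(a,c)`-bad or the complement of a `(c,a)`-bad
  have hMlab : ∀ X ∈ D, (f (M X) = petal a ∧ (i X = a ∨ (i X ≠ a ∧ j X = a))) ∨
      (f (M X) = petal c ∧ i X = b ∧ j X = c) := by
    intro X hX
    by_cases h : i X = a
    · left; rw [hMpl X h, hDi X hX, h]; exact ⟨rfl, Or.inl rfl⟩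
    · rw [hMco X h, hDj X hX]
      rcases hT X hX with ⟨h1, -⟩ | ⟨h1, h2 | h2⟩ | ⟨h1, h2⟩
      · exact absurd h1 h
      · left; exact ⟨by rw [h2], Or.inr ⟨h, h2⟩⟩
      · right; exact ⟨by rw [h2], h1, h2⟩
      · left; exact ⟨by rw [h2], Or.inr ⟨h, h2⟩⟩
  have hMcolab : ∀ X ∈ D, (f (S \ M X) = petal b) ∨
      (f (S \ M X) = petal c ∧ ((i X = a ∧ j X = c) ∨ (i X = c ∧ j X = a))) := by
    intro X hX
    by_cases h : i X = a
    · rw [hMpl X h, hDj X hX]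
      rcases hT X hX with ⟨h1, h2 | h2⟩ | ⟨h1, -⟩ | ⟨h1, -⟩
      · left; rw [h2]
      · right; exact ⟨by rw [h2], Or.inl ⟨h1, h2⟩⟩
      · exact absurd h (by rw [h1]; exact fun e => hab e.symm)
      · exact absurd h (by rw [h1]; exact fun e => hac e.symm)
    · rw [hMco X h, Finset.sdiff_sdiff_eq_self (hDS X hX), hDi X hX]
      rcases hT X hX with ⟨h1, -⟩ | ⟨h1, -⟩ | ⟨h1, h2⟩
      · exact absurd h1 h
      · left; rw [h1]
      · right; exact ⟨by rw [h1], Or.inr ⟨h1, h2⟩⟩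
  -- the complement-label of a member is never `A`, the set-label never `B`
  have hMcolab_ne_top : ∀ X ∈ D, f (S \ M X) ≠ top := by
    intro X hX h
    rcases hMcolab X hX with h' | ⟨h', -⟩ <;> rw [h'] at h <;> cases h
  -- injectivity of `M` on `D` (co-intersection for the mixed case)
  have hMinj : ∀ X ∈ D, ∀ X' ∈ D, M X = M X' → X = X' := by
    intro X hX X' hX' hMM'
    by_cases h : i X = a <;> by_cases h' : i X' = a
    · rwa [hMpl X h, hMpl X' h'] at hMM'
    · exfalso
      rw [hMpl X h, hMco X' h'] at hMM'
      refine hco X' hX' X hX ?_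
      rw [hMM', union_sdiff_of_subset (hDS X' hX')]
    · exfalso
      rw [hMco X h, hMpl X' h'] at hMM'
      refine hco X hX X' hX' ?_
      rw [← hMM', union_sdiff_of_subset (hDS X hX)]
    · rw [hMco X h, hMco X' h'] at hMM'
      rw [← Finset.sdiff_sdiff_eq_self (hDS X hX), hMM', Finset.sdiff_sdiff_eq_self (hDS X' hX')]
  -- the pseudo-sets: the whole class `Φ_c`, restricted to sets disjoint from a bad
  set P : Finset (Finset α) :=
    {E ∈ S.powerset | (∃ Y ∈ D, Disjoint E Y) ∧ f E = petal c ∧ f (S \ E) = top} with hP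
  have hPmem : ∀ E, E ∈ P ↔ E ⊆ S ∧ (∃ Y ∈ D, Disjoint E Y) ∧ f E = petal c ∧ f (S \ E) = top := by
    intro E; rw [hP, mem_filter, mem_powerset]
  -- a member is never a pseudo-set
  have hMnotP : ∀ X ∈ D, M X ∉ P := by
    intro X hX h
    exact hMcolab_ne_top X hX ((hPmem _).1 h).2.2.2
  -- the target predicate: pseudo-set or certified co-good, from four label facts
  have hclaim : ∀ Z, Z ⊆ S → (∃ Y ∈ D, Disjoint Z Y) → f (S \ Z) = top → (f Z = bot ∨ f Z = petal c) →
      Z ∈ P ∨ (Z ⊆ S ∧ f Z = bot ∧ f (S \ Z) = top ∧ ∃ Y ∈ D, Disjoint Z Y) := by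
    intro Z hZS hZY hZt hZl
    rcases hZl with h | h
    · exact Or.inr ⟨hZS, h, hZt, hZY⟩
    · exact Or.inl ((hPmem Z).2 ⟨hZS, hZY, h, hZt⟩)
  -- ranks: three blocks, non-increasing size inside
  set N : ℕ := #S with hN
  let blk : Finset α → ℕ := fun X => if i X = a then 2 else if j X = c then 0 else 1
  let ρM : Finset α → ℕ := fun X => blk X * (N + 1) + (N - #(M X))
  let ρP : Finset α → ℕ := fun E => N - #E
  have hcard_le : ∀ U, U ⊆ S → #U ≤ N := fun U hU => by rw [hN]; exact card_le_card hU
  -- size comparison inside a block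
  have hsize : ∀ U V : Finset α, U ⊆ S → V ⊆ S → N - #U ≤ N - #V → #V ≤ #U := by
    intro U V hU hV h
    have h1 := hcard_le U hU; have h2 := hcard_le V hV
    omega
  have hnotsub_of_size : ∀ U V : Finset α, U ≠ V → #V ≤ #U → ¬ U ⊆ V := by
    intro U V hne hle hsub
    exact hne (eq_of_subset_of_card_le hsub hle)
  -- block facts
  have hblk2 : ∀ X, i X = a → blk X = 2 := fun X h => by simp only [blk, h, if_true]
  have hblk0 : ∀ X, i X ≠ a → j X = c → blk X = 0 := fun X h h' => by simp only [blk, h, h', if_false, if_true]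
  have hblk1 : ∀ X, i X ≠ a → j X ≠ c → blk X = 1 := fun X h h' => by simp only [blk, h, h', if_false]
  have hblk_le2 : ∀ X, blk X ≤ 2 := by
    intro X
    by_cases h : i X = a
    · rw [hblk2 X h]
    · by_cases h' : j X = c
      · rw [hblk0 X h h']; norm_num
      · rw [hblk1 X h h']; norm_num
  have hrank_blk : ∀ X ∈ D, ∀ X' ∈ D, ρM X ≤ ρM X' → blk X ≤ blk X' := by
    intro X hX X' hX' h
    by_contra hlt
    rw [not_le] at hlt
    have h1 : N - #(M X) ≤ N := Nat.sub_le _ _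
    have h2 : N - #(M X') ≤ N := Nat.sub_le _ _
    have : blk X' + 1 ≤ blk X := hlt
    have key : (blk X' + 1) * (N + 1) ≤ blk X * (N + 1) := Nat.mul_le_mul_right _ this
    simp only [ρM] at h
    nlinarith
  have hrank_size : ∀ X ∈ D, ∀ X' ∈ D, ρM X ≤ ρM X' → blk X = blk X' → #(M X') ≤ #(M X) := by
    intro X hX X' hX' h he
    simp only [ρM] at h
    rw [he] at h
    exact hsize (M X) (M X') (hMS X hX) (hMS X' hX') (by omega)
  -- label consequences of the blocks
  have hlab_c_of_blk0 : ∀ X ∈ D, blk X = 0 → f (M X) = petal c ∧ f (S \ M X) = petal b := by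
    intro X hX h0
    by_cases h : i X = a
    · rw [hblk2 X h] at h0; cases h0
    · by_cases h' : j X = c
      · refine ⟨?_, ?_⟩
        · rw [hMco X h, hDj X hX, h']
        · rcases hMcolab X hX with hh | ⟨-, ⟨h1, -⟩ | ⟨-, h2⟩⟩
          · exact hh
          · exact absurd h1 h
          · exact absurd h2 (by rw [h']; exact fun e => hac e.symm)
      · rw [hblk1 X h h'] at h0; cases h0
  have hlab_a_of_blk_pos : ∀ X ∈ D, blk X ≠ 0 → f (M X) = petal a := by
    intro X hX h0
    rcases hMlab X hX with ⟨hh, -⟩ | ⟨-, h1, h2⟩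
    · exact hh
    · exfalso
      exact h0 (hblk0 X (by rw [h1]; exact fun e => hab e.symm) h2)
  have hcolab_c : ∀ X ∈ D, f (S \ M X) = petal c → blk X ≠ 0 := by
    intro X hX h h0
    have := (hlab_c_of_blk0 X hX h0).2
    rw [this] at h
    exact hbc (petal.inj h)
  -- (L): along the ranks the set-label of a difference of members is `B` or `C_c`
  -- (T): and its complement-label is `A`
  -- the three hypothesis families of the socket
  refine card_le_card_goods_above_of_orderedTwoSided S hf D i j hDS hDi hDj hij M P ρM ρP ?_ ?_ ?_
  · -- member / member
    intro X hX X' hX' hne hle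
    have hMne : M X ≠ M X' := fun h => hne (hMinj X hX X' hX' h)
    have hbl := hrank_blk X hX X' hX' hle
    -- non-containment
    have hN' : ¬ M X ⊆ M X' := by
      rcases Nat.lt_or_ge (blk X) (blk X') with hlt | hge
      · -- different blocks: labels `C_c ⊄ C_a`, or co-intersection for block 1 into block 2
        by_cases h0 : blk X = 0
        · have hc := (hlab_c_of_blk0 X hX h0).1
          have ha := hlab_a_of_blk_pos X' hX' (by omega)
          exact not_subset_of_labels (S := S) hf (Or.inr (Or.inr ⟨c, a, hc, ha, fun e => hac e.symm⟩))
        · -- blk X = 1, blk X' = 2: `S \ X ⊆ X'` contradicts co-intersection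
          have h2 : blk X' = 2 := by have := hblk_le2 X'; omega
          have hiX' : i X' = a := by
            by_contra hh
            by_cases hj : j X' = c
            · rw [hblk0 X' hh hj] at h2; cases h2
            · rw [hblk1 X' hh hj] at h2; cases h2
          have hiX : i X ≠ a := fun hh => by rw [hblk2 X hh] at hlt; omega
          rw [hMco X hiX, hMpl X' hiX']
          intro hsub
          refine hco X hX X' hX' ?_
          apply Subset.antisymm (union_subset (hDS X hX) (hDS X' hX'))
          intro x hx
          by_cases hxX : x ∈ X
          · exact mem_union_left _ hxX
          · exact mem_union_right _ (hsub (mem_sdiff.2 ⟨hx, hxX⟩))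
      · have heq : blk X = blk X' := le_antisymm hbl hge
        exact hnotsub_of_size _ _ hMne (hrank_size X hX X' hX' hle heq)
    refine ⟨hN', hclaim _ (sdiff_subset.trans (hMS X hX)) ?_ ?_ ?_⟩
    · -- witness of disjointness
      by_cases h : i X = a
      · -- plain; then `X'` is plain too
        have h2 : blk X' = 2 := by have := hblk_le2 X'; rw [hblk2 X h] at hbl; omega
        have hiX' : i X' = a := by
          by_contra hh
          by_cases hj : j X' = c
          · rw [hblk0 X' hh hj] at h2; cases h2
          · rw [hblk1 X' hh hj] at h2; cases h2
        refine ⟨X', hX', ?_⟩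
        rw [hMpl X' hiX']
        exact disjoint_sdiff_self_left
      · refine ⟨X, hX, ?_⟩
        rw [hMco X h]
        exact (disjoint_sdiff_self_left).mono_left sdiff_subset
    · -- complement-label `A`: `S \ (M X \ M X') ⊇ S \ M X` and `⊇ M X'`, with different petal labels
      have hsup1 : S \ M X ⊆ S \ (M X \ M X') := sdiff_subset_sdiff le_rfl sdiff_subset
      have hsup2 : M X' ⊆ S \ (M X \ M X') := by
        intro x hx
        exact mem_sdiff.2 ⟨hMS X' hX' hx, fun h => (mem_sdiff.1 h).2 hx⟩
      rcases hMcolab X hX with hqb | ⟨hqc, hcase⟩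
      · -- complement-label `C_b`, set-label of `M X'` is `C_a` or `C_c`
        rcases hMlab X' hX' with ⟨hpa, -⟩ | ⟨hpc, -, -⟩
        · exact eq_top_of_petal_le (fun e => hab e.symm) (hqb ▸ hf hsup1) (hpa ▸ hf hsup2)
        · exact eq_top_of_petal_le hbc (hqb ▸ hf hsup1) (hpc ▸ hf hsup2)
      · -- complement-label `C_c`: then `blk X ≥ 1`, so `blk X' ≥ 1` and `f (M X') = C_a`
        have h0 : blk X ≠ 0 := hcolab_c X hX hqc
        have hpa := hlab_a_of_blk_pos X' hX' (by omega)
        exact eq_top_of_petal_le (fun e => hac e.symm) (hqc ▸ hf hsup1) (hpa ▸ hf hsup2)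
    · -- set-label `B` or `C_c`
      rcases hMlab X hX with ⟨hpa, -⟩ | ⟨hpc, -, -⟩
      · -- `M X` has label `C_a`; `M X \ M X' ⊆ S \ M X'` whose label is `C_b` or `C_c`
        left
        have hsub2 : M X \ M X' ⊆ S \ M X' := sdiff_subset_sdiff (hMS X hX) le_rfl
        rcases hMcolab X' hX' with hqb | ⟨hqc, -⟩
        · exact eq_bot_of_le_petal hab (hpa ▸ hf sdiff_subset) (hqb ▸ hf hsub2)
        · exact eq_bot_of_le_petal hac (hpa ▸ hf sdiff_subset) (hqc ▸ hf hsub2)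
      · exact label_sub_of_petal hf sdiff_subset hpc
  · -- member / pseudo-set
    intro X hX E hE
    obtain ⟨hES, ⟨Y, hY, hEY⟩, hEc, hEt⟩ := (hPmem E).1 hE
    have hEne : M X ≠ E := fun h => hMnotP X hX (h ▸ hE)
    constructor
    · intro hle
      -- only block 0 members can precede a pseudo-set
      have h0 : blk X = 0 := by
        by_contra hh
        have : 1 ≤ blk X := Nat.one_le_iff_ne_zero.mpr hh
        have h1 : N - #E ≤ N := Nat.sub_le _ _
        simp only [ρM, ρP] at hle
        nlinarith
      have ⟨hc, hb⟩ := hlab_c_of_blk0 X hX h0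
      have hszle : #E ≤ #(M X) := by
        simp only [ρM, ρP, h0, zero_mul, zero_add] at hle
        exact hsize _ _ (hMS X hX) hES hle
      refine ⟨hnotsub_of_size _ _ hEne hszle, hclaim _ (sdiff_subset.trans (hMS X hX)) ?_ ?_ ?_⟩
      · have hiX : i X ≠ a := fun hh => by rw [hblk2 X hh] at h0; cases h0
        refine ⟨X, hX, ?_⟩
        rw [hMco X hiX]
        exact (disjoint_sdiff_self_left).mono_left sdiff_subset
      · have hsup1 : S \ M X ⊆ S \ (M X \ E) := sdiff_subset_sdiff le_rfl sdiff_subset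
        have hsup2 : E ⊆ S \ (M X \ E) := fun x hx => mem_sdiff.2 ⟨hES hx, fun h => (mem_sdiff.1 h).2 hx⟩
        exact eq_top_of_petal_le hbc (hb ▸ hf hsup1) (hEc ▸ hf hsup2)
      · exact label_sub_of_petal hf sdiff_subset hc
    · intro hle
      refine ⟨?_, hclaim _ (sdiff_subset.trans hES) ⟨Y, hY, hEY.mono_left sdiff_subset⟩
        (label_top_of_subset hf (sdiff_subset_sdiff le_rfl sdiff_subset) hEt)
        (label_sub_of_petal hf sdiff_subset hEc)⟩
      -- non-containment `E ⊄ M X`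
      by_cases h0 : blk X = 0
      · have hszle : #(M X) ≤ #E := by
          simp only [ρM, ρP, h0, zero_mul, zero_add] at hle
          exact hsize _ _ hES (hMS X hX) hle
        exact hnotsub_of_size _ _ (Ne.symm hEne) hszle
      · have ha := hlab_a_of_blk_pos X hX h0
        exact not_subset_of_labels (S := S) hf (Or.inr (Or.inr ⟨c, a, hEc, ha, fun e => hac e.symm⟩))
  · -- pseudo-set / pseudo-set
    intro E hE E' hE' hne hle
    obtain ⟨hES, ⟨Y, hY, hEY⟩, hEc, hEt⟩ := (hPmem E).1 hE
    obtain ⟨hE'S, -, -, -⟩ := (hPmem E').1 hE'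
    have hszle : #E' ≤ #E := by
      simp only [ρP] at hle
      exact hsize _ _ hES hE'S hle
    exact ⟨hnotsub_of_size _ _ hne hszle, hclaim _ (sdiff_subset.trans hES) ⟨Y, hY, hEY.mono_left sdiff_subset⟩
      (label_top_of_subset hf (sdiff_subset_sdiff le_rfl sdiff_subset) hEt)
      (label_sub_of_petal hf sdiff_subset hEc)⟩

/-- **SDR form** of `card_le_card_goods_above_of_coint_fiveTypes`: under the same hypotheses the bads of `D` have
DISTINCT good representatives above them (an injective `φ` on `D` with `X ⊆ φ X ⊆ S`, `f (φ X) = A`, `f (S \ φ X) = B`).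
[this work] -/
theorem exists_injective_good_above_of_coint_fiveTypes (S : Finset α) {f : Finset α → Lab k}
    (hf : ∀ ⦃X Y : Finset α⦄, X ⊆ Y → f X ≤ f Y) (D : Finset (Finset α)) (i j : Finset α → Fin k)
    (hDS : ∀ X ∈ D, X ⊆ S) (hDi : ∀ X ∈ D, f X = petal (i X)) (hDj : ∀ X ∈ D, f (S \ X) = petal (j X))
    {a b c : Fin k} (hab : a ≠ b) (hac : a ≠ c) (hbc : b ≠ c)
    (hT : ∀ X ∈ D, (i X = a ∧ (j X = b ∨ j X = c)) ∨ (i X = b ∧ (j X = a ∨ j X = c)) ∨ (i X = c ∧ j X = a))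
    (hco : ∀ X ∈ D, ∀ Y ∈ D, X ∪ Y ≠ S) :
    ∃ φ : D → Finset α, Function.Injective φ ∧
      ∀ X : D, (X : Finset α) ⊆ φ X ∧ φ X ⊆ S ∧ f (φ X) = top ∧ f (S \ φ X) = bot := by
  classical
  let t : D → Finset (Finset α) := fun X =>
    {U ∈ S.powerset | f U = top ∧ f (S \ U) = bot ∧ (X : Finset α) ⊆ U}
  have hHall : ∀ s : Finset D, #s ≤ #(s.biUnion t) := by
    intro s
    set D' : Finset (Finset α) := s.map (Function.Embedding.subtype _) with hD'
    have hD'sub : ∀ X ∈ D', X ∈ D := by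
      intro X hX
      obtain ⟨x, -, rfl⟩ := mem_map.mp hX
      exact x.2
    have hcard : #s = #D' := (card_map _).symm
    have hle := card_le_card_goods_above_of_coint_fiveTypes S hf D' i j (fun X hX => hDS X (hD'sub X hX))
      (fun X hX => hDi X (hD'sub X hX)) (fun X hX => hDj X (hD'sub X hX)) hab hac hbc
      (fun X hX => hT X (hD'sub X hX)) (fun X hX Y hY => hco X (hD'sub X hX) Y (hD'sub Y hY))
    have hgoods : {U ∈ S.powerset | f U = top ∧ f (S \ U) = bot ∧ ∃ X ∈ D', X ⊆ U} ⊆ s.biUnion t := by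
      intro U hU
      rw [mem_filter, mem_powerset] at hU
      obtain ⟨hUS, hUtop, hUbot, X, hX, hXU⟩ := hU
      obtain ⟨x, hx, rfl⟩ := mem_map.mp hX
      rw [mem_biUnion]
      refine ⟨x, hx, ?_⟩
      simp only [t, mem_filter, mem_powerset]
      exact ⟨hUS, hUtop, hUbot, hXU⟩
    calc #s = #D' := hcard
      _ ≤ #{U ∈ S.powerset | f U = top ∧ f (S \ U) = bot ∧ ∃ X ∈ D', X ⊆ U} := hle
      _ ≤ #(s.biUnion t) := card_le_card hgoods
  obtain ⟨φ, hφinj, hφ⟩ := (all_card_le_biUnion_card_iff_exists_injective t).mp hHall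
  refine ⟨φ, hφinj, fun X => ?_⟩
  have hX := hφ X
  simp only [t, mem_filter, mem_powerset] at hX
  exact ⟨hX.2.2.2, hX.1, hX.2.1, hX.2.2.1⟩

end OrientedAntipodalHall

end Summit.CriticalPhenomena.PercolationContinuityZ3.Theorems
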